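import Summits.AtomisticToContinuum.Crystallization.Theorems.FrustratedLawDichotomyStrainedPatchHomEntryRadial
import Summits.AtomisticToContinuum.Crystallization.Theorems.FrustratedLawDichotomyStrainedPatchHomEntrySymBox

/-!
# `(H)` TARGET CERTIFICATE v3 (critic row 853): fcc six-coordinate search with the RADIAL prune, hcp nine-coordinate search with the SHARP fit

decomp-a2c hand-2 g23 (crux `AperiodicFrustratedLawGap`, stmt-AtomisticToContinuum-27623).  Critic row 853 fixed the (H) target certificate as
`homFloor_625_of_entrySearches6RS hF hH` with `hF : searchOK (entryLeafOK6R muRec) …` (hand-1 g21 `…HomEntryRadial`: radial-bad prune ∨ fundamental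
domain ∨ fit ∨ symmetry ∨ column ∨ table, through `symIdx`) and `hH : searchOK (entryLeafOKH3S muRec) …`, `entryLeafOKH3S := entryLeafOKH3 ∘ symIdxH`
(the sharp hcp fit of `…HomEntryFitHcpSharp` through the mirror — this IS `…HomEntrySymBox.entryLeafOKH3s`, see `…HomEntrySixBest.entryLeafOKH3s_eq`).

* §1 ★★★ `homFloor_of_entrySearches6RS` (all `m`, `μ`), `homFloor_625_of_entrySearches6RS` (THE v3 TARGET, any selectors) and the `1/1000` twin;
* §2 the union fcc verdict `entryLeafOK6RB μ := radOK ∘ symIdx ∨ entryLeafOKDBs μ` (radial prune ∨ fundamental domain × BEST fit: `fitOK3 ∨ fitOK2 ∨ fitOK ∨ …`),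
  its domain-relative soundness, `fccHalf_of_entrySearch6RB`, and ★★★ `homFloor_625_of_entrySearches6RBS` (+ generic and `1/1000` forms) — the same
  certificate shape with every fcc prune in the tree switched on.

One definition (`entryLeafOK6RB`); 0 sorry; standard axioms; no instances / notation / `#eval`.  `--supports stmt-AtomisticToContinuum-27623`.
-/

namespace Summit.AtomisticToContinuum.Crystallization.Theorems.FrustratedLawDichotomyStrainedPatchHomEntrySixHcpSharp

open scoped BigOperators RealInnerProductSpace
open Literature.Analysis.ValidatedNumerics.Numerics
open Summit.AtomisticToContinuum.Crystallization.Theorems.ChargedEnergyGapNegative (E3)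
open Summit.AtomisticToContinuum.Crystallization.Theorems.FrustratedLawDichotomySchurCut (effPot w₄₅ ω₄)
open Summit.AtomisticToContinuum.Crystallization.Theorems.FrustratedLawDichotomyAveragingRuleTightFree (TightNearCap BadNearCap)
open Summit.AtomisticToContinuum.Crystallization.Theorems.FrustratedLawDichotomyExemptAbsorption (ExemptNear)
open Summit.AtomisticToContinuum.Crystallization.Theorems.FrustratedLawDichotomyStrainedPatchHomSplit
open Summit.AtomisticToContinuum.Crystallization.Theorems.FrustratedLawDichotomyStrainedPatchHomPrunedPolar (homFloor_of_prunedBoxSums_selfAdjoint)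
open Summit.AtomisticToContinuum.Crystallization.Theorems.FrustratedLawDichotomyStrainedPatchHomEntryGram (rootC rootW)
open Summit.AtomisticToContinuum.Crystallization.Theorems.FrustratedLawDichotomyStrainedPatchHomEntryGramHcp (rootCH rootWH)
open Summit.AtomisticToContinuum.Crystallization.Theorems.FrustratedLawDichotomyStrainedPatchHomEntryTable (muRec muRec_ok)
open Summit.AtomisticToContinuum.Crystallization.Theorems.FrustratedLawDichotomyStrainedPatchHomEntrySearch (searchOK exists_tree_of_searchOK)
open Summit.AtomisticToContinuum.Crystallization.Theorems.FrustratedLawDichotomyStrainedPatchHomEntrySign (fccHalf_of_entryTreeDom)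
open Summit.AtomisticToContinuum.Crystallization.Theorems.FrustratedLawDichotomyStrainedPatchHomEntrySix (symIdx hbox_sym muMilli muMilli_ok)
open Summit.AtomisticToContinuum.Crystallization.Theorems.FrustratedLawDichotomyStrainedPatchHomEntryRadial
  (radOK radOK_sound entryLeafOK6R fccHalf_of_entrySearch6R)
open Summit.AtomisticToContinuum.Crystallization.Theorems.FrustratedLawDichotomyStrainedPatchHomEntrySymBox
  (entryLeafOKDBs entryLeafOKDBs_sound entryLeafOKH3s hcpHalf_of_entrySearchSym)
open Literature.Barriers.AtomisticToContinuum.FlatleyTheil2015 (fccVec)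

/-! ## §1. The v3 target certificate: `entryLeafOK6R` × `entryLeafOKH3s` -/

/-- ★★★ **`(H) HomFloor m` FROM THE TWO v3 SEARCHES** (fcc: radial prune, six coordinates; hcp: sharp fit, nine coordinates); every `m`, `μ` with
`2 (m + e_W) SC ≤ μ`, any selectors. [folklore] -/
theorem homFloor_of_entrySearches6RS {m : ℝ} {μ : ℤ} (hμ : 2 * (m + (-(7175 / 10000) + 3 / 400)) * SC ≤ μ)
    {selF : ℕ → (Fin 3 × Fin 3 → ℤ) → (Fin 3 × Fin 3 → ℤ) → Fin 3 × Fin 3} {fuelF dF : ℕ}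
    (hF : searchOK (entryLeafOK6R μ) selF fuelF dF rootC rootW = true)
    {selH : ℕ → ((Fin 3 × Fin 3) ⊕ Fin 3 → ℤ) → ((Fin 3 × Fin 3) ⊕ Fin 3 → ℤ) → (Fin 3 × Fin 3) ⊕ Fin 3} {fuelH dH : ℕ}
    (hH : searchOK (entryLeafOKH3s μ) selH fuelH dH rootCH rootWH = true) : HomFloor m :=
  homFloor_of_prunedBoxSums_selfAdjoint (fccHalf_of_entrySearch6R hμ hF) (hcpHalf_of_entrySearchSym hμ hH)

/-- ★★★ **THE (H) TARGET CERTIFICATE v3 (critic row 853)**: `HomFloor (1/625)` from `searchOK (entryLeafOK6R muRec) …` and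
`searchOK (entryLeafOKH3s muRec) …` (selectors of record: `…HomEntrySix.rr6`, `…HomEntrySixHcp.rr9H`; any are allowed). [folklore] -/
theorem homFloor_625_of_entrySearches6RS
    {selF : ℕ → (Fin 3 × Fin 3 → ℤ) → (Fin 3 × Fin 3 → ℤ) → Fin 3 × Fin 3} {fuelF dF : ℕ}
    (hF : searchOK (entryLeafOK6R muRec) selF fuelF dF rootC rootW = true)
    {selH : ℕ → ((Fin 3 × Fin 3) ⊕ Fin 3 → ℤ) → ((Fin 3 × Fin 3) ⊕ Fin 3 → ℤ) → (Fin 3 × Fin 3) ⊕ Fin 3} {fuelH dH : ℕ}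
    (hH : searchOK (entryLeafOKH3s muRec) selH fuelH dH rootCH rootWH = true) : HomFloor (1 / 625) :=
  homFloor_of_entrySearches6RS muRec_ok hF hH

/-- ★★★ The `1/1000` twin (`μ = muMilli`). [folklore] -/
theorem homFloor_milli_of_entrySearches6RS
    {selF : ℕ → (Fin 3 × Fin 3 → ℤ) → (Fin 3 × Fin 3 → ℤ) → Fin 3 × Fin 3} {fuelF dF : ℕ}
    (hF : searchOK (entryLeafOK6R muMilli) selF fuelF dF rootC rootW = true)
    {selH : ℕ → ((Fin 3 × Fin 3) ⊕ Fin 3 → ℤ) → ((Fin 3 × Fin 3) ⊕ Fin 3 → ℤ) → (Fin 3 × Fin 3) ⊕ Fin 3} {fuelH dH : ℕ}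
    (hH : searchOK (entryLeafOKH3s muMilli) selH fuelH dH rootCH rootWH = true) : HomFloor (1 / 1000) :=
  homFloor_of_entrySearches6RS muMilli_ok hF hH

/-! ## §2. The union fcc verdict: radial prune ∨ fundamental domain × best fit -/

/-- ★ **SIX-COORDINATE fcc VERDICT WITH EVERY PRUNE IN THE TREE**: radial-bad prune (through the mirror) ∨ `entryLeafOKDBs μ`
(sign ∨ dom ∨ `fitOK3 ∨ fitOK2 ∨ fitOK ∨ asymOK ∨ colOutOK ∨ table`, through the mirror). -/
def entryLeafOK6RB (μ : ℤ) (c w : Fin 3 × Fin 3 → ℤ) : Bool := radOK (c ∘ symIdx) (w ∘ symIdx) || entryLeafOKDBs μ c w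

/-- ★ Soundness of `entryLeafOK6RB` in the domain-relativised `hver` shape of `…HomEntrySign.fccHalf_of_entryTreeDom`. [folklore] -/
theorem entryLeafOK6RB_sound {μ : ℤ} {c w : Fin 3 × Fin 3 → ℤ} (h : entryLeafOK6RB μ c w = true) (U : E3 →L[ℝ] E3)
    (hsa : ∀ v v' : E3, ⟪U v, v'⟫ = ⟪v, U v'⟫) (hU : ‖U - 1‖ ≤ 1 / 4)
    (hbox : ∀ ab : Fin 3 × Fin 3, |(U (EuclideanSpace.single ab.2 (1 : ℝ))) ab.1 - (c ab : ℝ) / SC| ≤ (w ab : ℝ) / SC)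
    (h1 : (U (EuclideanSpace.single 1 (1 : ℝ))) 1 ≤ (U (EuclideanSpace.single 0 (1 : ℝ))) 0)
    (h2 : (U (EuclideanSpace.single 2 (1 : ℝ))) 2 ≤ (U (EuclideanSpace.single 1 (1 : ℝ))) 1)
    (h01 : 0 ≤ (U (EuclideanSpace.single 1 (1 : ℝ))) 0) (h02 : 0 ≤ (U (EuclideanSpace.single 2 (1 : ℝ))) 0) :
    (∀ (M : ℕ) (z : Fin M → E3) (c : Fin M), Function.Injective z →
        Set.range z = {x : E3 | dist x (z c) ≤ 133 / 10 ∧ ∃ a : Fin 3 → ℤ, x = z c + latPt U fccVec a} →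
        TightNearCap (9 / 5) (3 / 2) z c ∨ ExemptNear (9 / 5) ExRec z c ∨ BadNearCap (9 / 5) (3 / 2) z c) ∨
      (μ : ℝ) / SC ≤ ∑ b ∈ (Fintype.piFinset fun _ : Fin 3 => Finset.Icc (-7 : ℤ) 7).filter (fun b => b ≠ 0),
        effPot w₄₅ ω₄ (3 / 400) ‖latPt U fccVec b‖ := by
  simp only [entryLeafOK6RB, Bool.or_eq_true] at h
  rcases h with h | h
  · exact Or.inl (radOK_sound h U hU (hbox_sym hsa hbox))
  · exact entryLeafOKDBs_sound h U hsa hU hbox h1 h2 h01 h02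

/-- ★★ The fcc half from ONE six-coordinate search with the union verdict (any selector). [folklore] -/
theorem fccHalf_of_entrySearch6RB {m : ℝ} {μ : ℤ} (hμ : 2 * (m + (-(7175 / 10000) + 3 / 400)) * SC ≤ μ)
    {sel : ℕ → (Fin 3 × Fin 3 → ℤ) → (Fin 3 × Fin 3 → ℤ) → Fin 3 × Fin 3} {fuel d : ℕ}
    (h : searchOK (entryLeafOK6RB μ) sel fuel d rootC rootW = true) :
    ∀ U : E3 →L[ℝ] E3, (∀ v w : E3, inner ℝ (U v) w = inner ℝ v (U w)) → (∀ w : E3, 0 ≤ inner ℝ w (U w)) → ‖U - 1‖ ≤ 1 / 4 →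
      (∀ (M : ℕ) (z : Fin M → E3) (c : Fin M), Function.Injective z →
          Set.range z = {x : E3 | dist x (z c) ≤ 133 / 10 ∧ ∃ a : Fin 3 → ℤ, x = z c + latPt U fccVec a} →
          TightNearCap (9 / 5) (3 / 2) z c ∨ ExemptNear (9 / 5) ExRec z c ∨ BadNearCap (9 / 5) (3 / 2) z c) ∨
      m ≤ (∑ b ∈ (Fintype.piFinset fun _ : Fin 3 => Finset.Icc (-7 : ℤ) 7).filter (fun b => b ≠ 0),
        effPot w₄₅ ω₄ (3 / 400) ‖latPt U fccVec b‖) / 2 - (-(7175 / 10000) + 3 / 400) := by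
  obtain ⟨t, ht⟩ := exists_tree_of_searchOK (entryLeafOK6RB μ) sel fuel d rootC rootW h
  exact fccHalf_of_entryTreeDom hμ (entryLeafOK6RB μ)
    (fun _ _ hv U hsa hU hbox h1 h2 h01 h02 => entryLeafOK6RB_sound hv U hsa hU hbox h1 h2 h01 h02) ht

/-- ★★★ **`(H) HomFloor m` with every fcc prune and the sharp hcp fit** (any selectors). [folklore] -/
theorem homFloor_of_entrySearches6RBS {m : ℝ} {μ : ℤ} (hμ : 2 * (m + (-(7175 / 10000) + 3 / 400)) * SC ≤ μ)
    {selF : ℕ → (Fin 3 × Fin 3 → ℤ) → (Fin 3 × Fin 3 → ℤ) → Fin 3 × Fin 3} {fuelF dF : ℕ}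
    (hF : searchOK (entryLeafOK6RB μ) selF fuelF dF rootC rootW = true)
    {selH : ℕ → ((Fin 3 × Fin 3) ⊕ Fin 3 → ℤ) → ((Fin 3 × Fin 3) ⊕ Fin 3 → ℤ) → (Fin 3 × Fin 3) ⊕ Fin 3} {fuelH dH : ℕ}
    (hH : searchOK (entryLeafOKH3s μ) selH fuelH dH rootCH rootWH = true) : HomFloor m :=
  homFloor_of_prunedBoxSums_selfAdjoint (fccHalf_of_entrySearch6RB hμ hF) (hcpHalf_of_entrySearchSym hμ hH)

/-- ★★★ `HomFloor (1/625)` with every fcc prune and the sharp hcp fit. [folklore] -/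
theorem homFloor_625_of_entrySearches6RBS
    {selF : ℕ → (Fin 3 × Fin 3 → ℤ) → (Fin 3 × Fin 3 → ℤ) → Fin 3 × Fin 3} {fuelF dF : ℕ}
    (hF : searchOK (entryLeafOK6RB muRec) selF fuelF dF rootC rootW = true)
    {selH : ℕ → ((Fin 3 × Fin 3) ⊕ Fin 3 → ℤ) → ((Fin 3 × Fin 3) ⊕ Fin 3 → ℤ) → (Fin 3 × Fin 3) ⊕ Fin 3} {fuelH dH : ℕ}
    (hH : searchOK (entryLeafOKH3s muRec) selH fuelH dH rootCH rootWH = true) : HomFloor (1 / 625) :=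
  homFloor_of_entrySearches6RBS muRec_ok hF hH

/-- ★★★ `HomFloor (1/1000)` with every fcc prune and the sharp hcp fit. [folklore] -/
theorem homFloor_milli_of_entrySearches6RBS
    {selF : ℕ → (Fin 3 × Fin 3 → ℤ) → (Fin 3 × Fin 3 → ℤ) → Fin 3 × Fin 3} {fuelF dF : ℕ}
    (hF : searchOK (entryLeafOK6RB muMilli) selF fuelF dF rootC rootW = true)
    {selH : ℕ → ((Fin 3 × Fin 3) ⊕ Fin 3 → ℤ) → ((Fin 3 × Fin 3) ⊕ Fin 3 → ℤ) → (Fin 3 × Fin 3) ⊕ Fin 3} {fuelH dH : ℕ}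
    (hH : searchOK (entryLeafOKH3s muMilli) selH fuelH dH rootCH rootWH = true) : HomFloor (1 / 1000) :=
  homFloor_of_entrySearches6RBS muMilli_ok hF hH

/-- Kernel smoke test: the union verdict accepts a box off the fundamental domain (sign prune through the mirror: the `(1,0)` datum is read from `(0,1)`). -/
example : entryLeafOK6RB muRec (Function.update rootC (0, 1) (-3000)) (fun _ => 1000) = true := by
  decide +kernel

end Summit.AtomisticToContinuum.Crystallization.Theorems.FrustratedLawDichotomyStrainedPatchHomEntrySixHcpSharp
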